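import Summits.Ventures.LatticeQCDFlow.Exactness.FlowSamplerGroupSymmetrisationTauInt
import HarnessLib

/-!
# MORE SYMMETRISATION NEVER HURTS A SECTOR: the full group average `q̄_G` has no larger `τ_int` than ANY partial average `|S|⁻¹ Σ_{b ∈ S} q̃ ∘ t_b` over a sub-family of the group, sector by sector

HONEST FRAMING: exact (Metropolis-corrected) sampling algorithms for lattice gauge theory;
figures of merit are autocorrelation/cost numbers at stated couplings and volumes; no
continuum-physics claim.  (SCALAR calibration rung S0-A: not a gauge result.)

Venture `LatticeQCDFlow` (cell pub-lqcd), topic `Exactness`; FANOUT row 2 (`s0-phi4`, FLOW arm).  NEW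
WORK of the cell, continuing `FlowSamplerGroupSymmetrisationTauInt` (the group average `q̄_G =
|G|⁻¹ Σ_a q̃ ∘ t_a` of a flow density over a finite group of measure-preserving symmetries of the
target never increases `τ_int` of a sign-covariant observable).  Question: is it worth averaging over
the WHOLE group, or is a sub-family (a subgroup — translations without the flip, one lattice axis — or
just a few group elements) as good?  Answer, sector by sector: the whole group is never worse.

* `groupAvg_comp_mem` — `|G|⁻¹ Σ_a q̃(t_b(t_a x)) = q̄_G(x)` for every `b ∈ G` (reindex `a ↦ b·a`,
  `t_b ∘ t_a = t_{ba}`);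
* **`groupAvg_partialAvg_eq`** — for ANY nonempty finite family `s : ι → G`:
  `avg_G(|ι|⁻¹ Σ_i q̃ ∘ t_{s i}) = avg_G(q̃) = q̄_G` — the full average absorbs every partial one;
* **`groupAvg_tauInt_le_partialAvg_of_covariant`** — hence, for every `χ`-covariant square-integrable
  `g` (`g ∘ t_a = χ(a)·g`, `χ` multiplicative, `χ² = 1`, `Var g > 0`): if the normalised
  autocorrelation series of `g` under the PARTIALLY averaged flow `q̄_S = |ι|⁻¹ Σ_i q̃ ∘ t_{s i}` is
  summable, then under `q̄_G` it is summable and **`τ_int^{q̄_G}(g) ≤ τ_int^{q̄_S}(g)`** — apply the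
  group theorem to the flow `q̄_S`; `groupAvg_tauInt_le_partialAvg_of_invariant` (`χ ≡ 1`).

The lattice φ⁴ instances (signed site symmetries, `PolyObs`) are drawn in
`Phi4FlowLatticeSymmetrisationMonotone`.

So among all the `2^{|G|} − 1` partial symmetrisations of a flow, the full one is simultaneously optimal
on every symmetry sector (under summability) — while OFF the sectors even the full one can lose to the
raw flow (`FlowSamplerSymmetrisationMixedParity`).  Nothing is cited as a fact.

NOT CLAIMED: comparisons between two partial averages neither of which is the full group; anything
off the sectors; cost (`|G|` evaluations of `q̃` per proposal versus `|S|`); any value for any network.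
-/

namespace Summit.Ventures.LatticeQCDFlow.Exactness

open Real MeasureTheory Filter Finset Set Topology
open Summit.Ventures.LatticeQCDFlow.Scoring

section General

variable {X : Type*} [MeasurableSpace X] {μ : Measure X} [SFinite μ] {w q : X → ℝ}
  {G : Type*} [Fintype G] [Group G] {t : G → X ≃ᵐ X} {χ : G → ℝ}
  {ι : Type*} [Fintype ι] [Nonempty ι] {s : ι → G}

omit [MeasurableSpace X] [Fintype ι] [Nonempty ι] in
/-- `avg_G(q̃ ∘ t_b)(x) = |G|⁻¹ Σ_a q̃(t_b(t_a x)) = q̄_G(x)` for every group element `b`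
(reindex `a ↦ b·a`). -/
theorem groupAvg_comp_mem {t : G → X → X} (hmul : ∀ a b x, t (a * b) x = t a (t b x)) (b : G)
    (x : X) : (∑ a, q (t b (t a x))) / Fintype.card G = (∑ a, q (t a x)) / Fintype.card G := by
  congr 1
  simp_rw [← hmul]
  exact Fintype.sum_equiv (Equiv.mulLeft b) (fun a => q (t (b * a) x)) (fun c => q (t c x))
    fun a => rfl

omit [MeasurableSpace X] in
/-- **The full group average absorbs every partial average**: for any nonempty finite family
`s : ι → G`, `avg_G(|ι|⁻¹ Σ_i q̃ ∘ t_{s i}) = q̄_G`. -/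
theorem groupAvg_partialAvg_eq {t : G → X → X} (hmul : ∀ a b x, t (a * b) x = t a (t b x))
    (x : X) :
    (∑ a, (fun y => (∑ i, q (t (s i) y)) / Fintype.card ι) (t a x)) / Fintype.card G
      = (∑ a, q (t a x)) / Fintype.card G := by
  have hI : (0 : ℝ) < Fintype.card ι := by exact_mod_cast Fintype.card_pos
  have e : ∑ a, (fun y => (∑ i, q (t (s i) y)) / Fintype.card ι) (t a x)
      = (∑ i, ∑ a, q (t (s i) (t a x))) / Fintype.card ι := by
    simp only []
    rw [← Finset.sum_div, Finset.sum_comm]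
  rw [e, div_div, mul_comm, ← div_div]
  have e2 : (∑ i, ∑ a, q (t (s i) (t a x))) / Fintype.card G
      = ∑ i : ι, (∑ a, q (t a x)) / Fintype.card G := by
    rw [Finset.sum_div]
    exact Finset.sum_congr rfl fun i _ => groupAvg_comp_mem hmul (s i) x
  rw [e2, Finset.sum_const, Finset.card_univ, nsmul_eq_mul]
  field_simp

omit [SFinite μ] [Fintype G] [Group G] in
/-- The partial average `q̄_S = |ι|⁻¹ Σ_i q̃ ∘ t_{s i}` is a positive measurable normalised density. -/
theorem partialAvg_facts (ht : ∀ a, MeasurePreserving (t a) μ μ) (hq0 : ∀ x, 0 < q x)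
    (hqm : Measurable q) (hqi : Integrable q μ) (hq1 : ∫ z, q z ∂μ = 1) :
    (∀ x, 0 < (∑ i, q (t (s i) x)) / Fintype.card ι) ∧
    Measurable (fun x => (∑ i, q (t (s i) x)) / Fintype.card ι) ∧
    Integrable (fun x => (∑ i, q (t (s i) x)) / Fintype.card ι) μ ∧
    (∫ x, (∑ i, q (t (s i) x)) / Fintype.card ι ∂μ = 1) :=
  groupAvg_facts (t := fun i => t (s i)) (fun i => ht (s i)) hq0 hqm hqi hq1

/-- **MORE SYMMETRISATION NEVER HURTS A SECTOR.**  `G` finite acting by measure-preserving `t_a`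
(`t_{ab} = t_a ∘ t_b`, `w ∘ t_a = w`), `s : ι → G` any nonempty finite family, `q̄_S = |ι|⁻¹ Σ_i q̃ ∘ t_{s i}`
the partial average, `q̄_G` the full one; `g` square-integrable, `χ`-covariant (`χ` multiplicative,
`χ² = 1`), `Var g > 0`, its normalised series under `imhOp μ w q̄_S` summable.  Then the series under
`imhOp μ w q̄_G` is summable and `τ_int^{q̄_G}(g) ≤ τ_int^{q̄_S}(g)`. -/
theorem groupAvg_tauInt_le_partialAvg_of_covariant [Nonempty G]
    (ht : ∀ a, MeasurePreserving (t a) μ μ)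
    (hmul : ∀ a b x, t (a * b) x = t a (t b x)) (hw0 : ∀ x, 0 < w x) (hwm : Measurable w)
    (hwi : Integrable w μ) (hw : ∀ a x, w (t a x) = w x) (hq0 : ∀ x, 0 < q x) (hqm : Measurable q)
    (hqi : Integrable q μ) (hq1 : ∫ z, q z ∂μ = 1) (hχ : ∀ a b, χ (a * b) = χ a * χ b)
    (hχ2 : ∀ a, χ a ^ 2 = 1) {g : X → ℝ} (hgm : Measurable g)
    (hg2 : Integrable (fun x => g x ^ 2 * w x) μ) (hP : 0 < ∫ x, g x ^ 2 * w x ∂μ)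
    (hg : ∀ a x, g (t a x) = χ a * g x)
    (hs : Summable fun n => (∫ x, g x * ((imhOp μ w (fun y => (∑ i, q (t (s i) y)) / Fintype.card ι))^[n + 1]
        g) x * w x ∂μ) / ∫ x, g x ^ 2 * w x ∂μ) :
    (Summable fun n => (∫ x, g x * ((imhOp μ w (fun y => (∑ a, q (t a y)) / Fintype.card G))^[n + 1]
        g) x * w x ∂μ) / ∫ x, g x ^ 2 * w x ∂μ) ∧
    tauInt (fun n => (∫ x, g x * ((imhOp μ w (fun y => (∑ a, q (t a y)) / Fintype.card G))^[n] g) x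
        * w x ∂μ) / ∫ x, g x ^ 2 * w x ∂μ)
      ≤ tauInt (fun n => (∫ x, g x * ((imhOp μ w (fun y => (∑ i, q (t (s i) y)) / Fintype.card ι))^[n]
        g) x * w x ∂μ) / ∫ x, g x ^ 2 * w x ∂μ) := by
  obtain ⟨hS0, hSm, hSi, hS1⟩ := partialAvg_facts (s := s) ht hq0 hqm hqi hq1
  -- the full average is the group average OF the partial average
  have e : (fun y => (∑ a, q (t a y)) / Fintype.card G)
      = fun y => (∑ a, (fun z => (∑ i, q (t (s i) z)) / Fintype.card ι) (t a y)) / Fintype.card G :=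
    funext fun y => (groupAvg_partialAvg_eq (q := q) (s := s) (t := fun a => (t a : X → X)) hmul y).symm
  rw [e]
  exact groupAvg_tauInt_le_of_covariant (q := fun z => (∑ i, q (t (s i) z)) / Fintype.card ι) ht hmul
    hw0 hwm hwi hw hS0 hSm hSi hS1 hχ hχ2 hgm hg2 hP hg hs

/-- The invariant case (`χ ≡ 1`): `τ_int^{q̄_G}(g) ≤ τ_int^{q̄_S}(g)` for every invariant square-integrable
`g` whose `q̄_S`-series is summable. -/
theorem groupAvg_tauInt_le_partialAvg_of_invariant [Nonempty G]
    (ht : ∀ a, MeasurePreserving (t a) μ μ)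
    (hmul : ∀ a b x, t (a * b) x = t a (t b x)) (hw0 : ∀ x, 0 < w x) (hwm : Measurable w)
    (hwi : Integrable w μ) (hw : ∀ a x, w (t a x) = w x) (hq0 : ∀ x, 0 < q x) (hqm : Measurable q)
    (hqi : Integrable q μ) (hq1 : ∫ z, q z ∂μ = 1) {g : X → ℝ} (hgm : Measurable g)
    (hg2 : Integrable (fun x => g x ^ 2 * w x) μ) (hP : 0 < ∫ x, g x ^ 2 * w x ∂μ)
    (hg : ∀ a x, g (t a x) = g x)
    (hs : Summable fun n => (∫ x, g x * ((imhOp μ w (fun y => (∑ i, q (t (s i) y)) / Fintype.card ι))^[n + 1]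
        g) x * w x ∂μ) / ∫ x, g x ^ 2 * w x ∂μ) :
    (Summable fun n => (∫ x, g x * ((imhOp μ w (fun y => (∑ a, q (t a y)) / Fintype.card G))^[n + 1]
        g) x * w x ∂μ) / ∫ x, g x ^ 2 * w x ∂μ) ∧
    tauInt (fun n => (∫ x, g x * ((imhOp μ w (fun y => (∑ a, q (t a y)) / Fintype.card G))^[n] g) x
        * w x ∂μ) / ∫ x, g x ^ 2 * w x ∂μ)
      ≤ tauInt (fun n => (∫ x, g x * ((imhOp μ w (fun y => (∑ i, q (t (s i) y)) / Fintype.card ι))^[n]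
        g) x * w x ∂μ) / ∫ x, g x ^ 2 * w x ∂μ) :=
  groupAvg_tauInt_le_partialAvg_of_covariant (χ := fun _ => (1 : ℝ)) ht hmul hw0 hwm hwi hw hq0 hqm hqi
    hq1 (fun _ _ => by ring) (fun _ => by ring) hgm hg2 hP (fun a x => by rw [hg, one_mul]) hs

end General

end Summit.Ventures.LatticeQCDFlow.Exactness
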